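import Literature.Probability.Percolation.KSTPeriodicCorridor
import Literature.Probability.Percolation.KSTPeriodicArmDualityPlanar
import HarnessLib

/-!
# KST-type RSW for periodic measures: the arm / dual-bridge duality

Topic `Literature/Probability/Percolation`. Proof of the named statement `KSTPeriodic.ArmDuality`
of `KSTPeriodicStatements.lean` ([KohlerSchindlerTassion2023, §1 'Duality' and footnote 3]): for a
lattice configuration `ω`, the rectangle `R = [x₁, x₂] × [y₁, y₂]` and the targets
`[u₁, u₂] × {y₂}`, `[u₁, u₂] × {y₁}` (`x₁ < u₁ < u₂ < x₂`, `y₁ < y₂`), exactly one of "an open path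
of `R` joins the two targets" and "in the dual configuration of `ω ∩ E(R)` the left group of faces
is joined to the right group through allowed faces" holds (`armDuality`).

* Not both (`armDuality_not_both`): extend the open target-to-target walk by one vertical edge at
  each end, and the dual face walk by straight runs along the outside rows to the outer columns;
  by the transposed discrete Jordan curve theorem in the box `[x₁, x₂] × [y₁ - 1, y₂ + 1]`
  (`exists_dart_sepEdge_mem_edges_box`) some face step crosses an edge of the extended walk — an
  open edge of `R` (but the step is dual-open), or one of the two added vertical edges (but the two
  faces beside such an edge are never both allowed, as `u₁ < u₂`: `armDuality_sepEdge_ne`).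
* At least one (`armDuality_dual_of_not_primal`): colour a vertex when it lies on the row below
  `R` or is joined inside `R` to the lower target by `ω ∩ E(R)`; the parity lemma in the box
  `[x₁, x₂] × [y₁ - 1, y₂ + 1]` (`exists_faceWalk_box`) gives a face walk from the right outer
  column to the left outer column crossing only colour-changing edges; such an edge is never an
  open edge of `R`, and when the targets are not joined no colour-changing edge leads into a face
  above or below a target edge (`armDuality_no_step_into_middle`), so the walk runs through
  allowed faces.

## References

* [KohlerSchindlerTassion2023] L. Köhler-Schindler, V. Tassion, *Crossing probabilities for
  planar percolation*, Duke Math. J. 172 (2023) 809–838, §1 'Duality', footnote 3.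
* [BollobasRiordan2006] B. Bollobás, O. Riordan, *Percolation* (2006), Ch. 3, Lemma 1.
-/

namespace Literature.Probability.Percolation

open LatticeModels SimpleGraph

noncomputable section

namespace KSTPeriodic

/-! ### The two halves of the duality -/

/-- Beside a vertical edge `{w, w + e₁}` at a target abscissa `u₁ ≤ w₀ ≤ u₂` on the row just below
`R` or on its top row, the two faces are never both allowed faces (inside `R`, left group, right
group) — here `u₁ < u₂` is used. [cite: KohlerSchindlerTassion2023, §1 Duality, footnote 3] -/
theorem armDuality_sepEdge_ne {x₁ x₂ y₁ y₂ u₁ u₂ : ℤ} (hxu : x₁ < u₁) (hu : u₁ < u₂) (hux : u₂ < x₂)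
    {z z' : Site 2} (hadj : (zdGraph 2).Adj z z')
    (hz : z ∈ {f : Site 2 | x₁ ≤ f 0 ∧ f 0 ≤ x₂ - 1 ∧ y₁ ≤ f 1 ∧ f 1 ≤ y₂ - 1} ∪
      {f : Site 2 | (f 0 = x₁ - 1 ∧ y₁ - 1 ≤ f 1 ∧ f 1 ≤ y₂) ∨
        ((f 1 = y₂ ∨ f 1 = y₁ - 1) ∧ x₁ ≤ f 0 ∧ f 0 ≤ u₁ - 1)} ∪
      {f : Site 2 | (f 0 = x₂ ∧ y₁ - 1 ≤ f 1 ∧ f 1 ≤ y₂) ∨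
        ((f 1 = y₂ ∨ f 1 = y₁ - 1) ∧ u₂ ≤ f 0 ∧ f 0 ≤ x₂ - 1)})
    (hz' : z' ∈ {f : Site 2 | x₁ ≤ f 0 ∧ f 0 ≤ x₂ - 1 ∧ y₁ ≤ f 1 ∧ f 1 ≤ y₂ - 1} ∪
      {f : Site 2 | (f 0 = x₁ - 1 ∧ y₁ - 1 ≤ f 1 ∧ f 1 ≤ y₂) ∨
        ((f 1 = y₂ ∨ f 1 = y₁ - 1) ∧ x₁ ≤ f 0 ∧ f 0 ≤ u₁ - 1)} ∪
      {f : Site 2 | (f 0 = x₂ ∧ y₁ - 1 ≤ f 1 ∧ f 1 ≤ y₂) ∨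
        ((f 1 = y₂ ∨ f 1 = y₁ - 1) ∧ u₂ ≤ f 0 ∧ f 0 ≤ x₂ - 1)})
    {w : Site 2} (hw0 : u₁ ≤ w 0) (hw0' : w 0 ≤ u₂) (hw1 : w 1 = y₁ - 1 ∨ w 1 = y₂)
    (hE : sepEdge z z' = s(w, w + Pi.single 1 1)) : False := by
  have h1 := sepEdge_subset_face hadj (by rw [hE]; exact Sym2.mem_mk_left _ _)
  have h2 := sepEdge_subset_face hadj (by rw [hE]; exact Sym2.mem_mk_right _ _)
  rw [sepEdge_comm] at hE
  have h3 := sepEdge_subset_face hadj.symm (by rw [hE]; exact Sym2.mem_mk_left _ _)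
  have h4 := sepEdge_subset_face hadj.symm (by rw [hE]; exact Sym2.mem_mk_right _ _)
  simp only [Pi.add_apply, single_one_apply_zero, single_one_apply_one, add_zero] at h2 h4
  simp only [Set.mem_union, Set.mem_setOf_eq] at hz hz'
  rcases stepKind_of_adj hadj with ⟨h0, h1'⟩ | ⟨h0, h1'⟩ | ⟨h1', h0⟩ | ⟨h1', h0⟩ <;> omega

/-- When the targets are not joined inside `R`, no colour-changing edge of
`[x₁, x₂] × [y₁ - 1, y₂ + 1]` (colour: on the row below `R`, or joined inside `R` to the lower
target) leads from a face of `[x₁ - 1, x₂] × [y₁ - 1, y₂]` into a face just above or just below a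
target edge. [cite: KohlerSchindlerTassion2023, §1 Duality, footnote 3] -/
theorem armDuality_no_step_into_middle {x₁ x₂ y₁ y₂ u₁ u₂ : ℤ} (hxu : x₁ < u₁) (hux : u₂ < x₂)
    (hy : y₁ < y₂) {ω : BondConfig (Site 2)}
    (hA : ω ∉ openCrossing {x : Site 2 | x₁ ≤ x 0 ∧ x 0 ≤ x₂ ∧ y₁ ≤ x 1 ∧ x 1 ≤ y₂}
      {x : Site 2 | u₁ ≤ x 0 ∧ x 0 ≤ u₂ ∧ x 1 = y₂} {x : Site 2 | u₁ ≤ x 0 ∧ x 0 ≤ u₂ ∧ x 1 = y₁})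
    {z z' : Site 2} (hadj : (zdGraph 2).Adj z z') (hz : y₁ - 1 ≤ z 1 ∧ z 1 ≤ y₂)
    (hz'1 : z' 1 = y₂ ∨ z' 1 = y₁ - 1) (hz'0 : u₁ ≤ z' 0) (hz'0' : z' 0 ≤ u₂ - 1)
    (hc : ((sepLo z z') 1 = y₁ - 1 ∨ ∃ t ∈ {x : Site 2 | u₁ ≤ x 0 ∧ x 0 ≤ u₂ ∧ x 1 = y₁},
        ω ∈ openConnIn {x : Site 2 | x₁ ≤ x 0 ∧ x 0 ≤ x₂ ∧ y₁ ≤ x 1 ∧ x 1 ≤ y₂} (sepLo z z') t) ↔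
      ¬((sepHi z z') 1 = y₁ - 1 ∨ ∃ t ∈ {x : Site 2 | u₁ ≤ x 0 ∧ x 0 ≤ u₂ ∧ x 1 = y₁},
        ω ∈ openConnIn {x : Site 2 | x₁ ≤ x 0 ∧ x 0 ≤ x₂ ∧ y₁ ≤ x 1 ∧ x 1 ≤ y₂} (sepHi z z') t)) :
    False := by
  -- on the two targets the colour is "lies on the lower target"
  have key : ∀ p : Site 2, u₁ ≤ p 0 → p 0 ≤ u₂ → (p 1 = y₂ ∨ p 1 = y₁) →
      ((p 1 = y₁ - 1 ∨ ∃ t ∈ {x : Site 2 | u₁ ≤ x 0 ∧ x 0 ≤ u₂ ∧ x 1 = y₁},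
        ω ∈ openConnIn {x : Site 2 | x₁ ≤ x 0 ∧ x 0 ≤ x₂ ∧ y₁ ≤ x 1 ∧ x 1 ≤ y₂} p t) ↔
        p 1 = y₁) := by
    intro p hp0 hp0' hp1
    constructor
    · rintro (h | ⟨t, ht, hpt⟩)
      · omega
      · rcases hp1 with h | h
        · exact absurd ⟨p, ⟨hp0, hp0', h⟩, t, ht, hpt⟩ hA
        · exact h
    · intro h
      exact Or.inr ⟨p, ⟨hp0, hp0', h⟩, openConnIn_refl ⟨by omega, by omega, by omega, by omega⟩⟩
  -- above `R` nothing is coloured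
  have hout : ∀ p : Site 2, p 1 = y₂ + 1 →
      ¬(p 1 = y₁ - 1 ∨ ∃ t ∈ {x : Site 2 | u₁ ≤ x 0 ∧ x 0 ≤ u₂ ∧ x 1 = y₁},
        ω ∈ openConnIn {x : Site 2 | x₁ ≤ x 0 ∧ x 0 ≤ x₂ ∧ y₁ ≤ x 1 ∧ x 1 ≤ y₂} p t) := by
    rintro p hp (h | ⟨t, -, hpt⟩)
    · omega
    · have := hpt.1
      simp only [Set.mem_setOf_eq] at this
      omega
  rcases stepKind_of_adj hadj with ⟨h0, h1⟩ | ⟨h0, h1⟩ | ⟨h1, h0⟩ | ⟨h1, h0⟩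
  · obtain rfl : z' = z + Pi.single 0 1 := by simp [Site.eq_iff_two, h0, h1]
    rw [sepLo_add_e0, sepHi_add_e0] at hc
    rcases hz'1 with h2 | h2
    · have k := key (z + Pi.single 0 1) hz'0 (by omega) (Or.inl h2)
      have o := hout (z + Pi.single 0 1 + Pi.single 1 1) (by simp at h2 ⊢; omega)
      have := k.1 (hc.2 o)
      simp at this h2
      omega
    · have k := key (z + Pi.single 0 1 + Pi.single 1 1) (by simp at hz'0 ⊢; omega)
        (by simp at hz'0' ⊢; omega) (Or.inr (by simp at h2 ⊢; omega))
      exact hc.1 (Or.inl h2) (k.2 (by simp at h2 ⊢; omega))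
  · obtain rfl : z = z' + Pi.single 0 1 := by simp [Site.eq_iff_two, h0, h1]
    rw [sepLo_comm, sepHi_comm, sepLo_add_e0, sepHi_add_e0] at hc
    rcases hz'1 with h2 | h2
    · have k := key (z' + Pi.single 0 1) (by simp; omega) (by simp; omega)
        (Or.inl (by simpa using h2))
      have o := hout (z' + Pi.single 0 1 + Pi.single 1 1) (by simp; omega)
      have := k.1 (hc.2 o)
      simp at this
      omega
    · have k := key (z' + Pi.single 0 1 + Pi.single 1 1) (by simp; omega) (by simp; omega)
        (Or.inr (by simp; omega))
      exact hc.1 (Or.inl (by simpa using h2)) (k.2 (by simp; omega))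
  · obtain rfl : z' = z + Pi.single 1 1 := by simp [Site.eq_iff_two, h0, h1]
    rw [sepLo_add_e1, sepHi_add_e1] at hc
    rcases hz'1 with h2 | h2
    · have k := key (z + Pi.single 1 1) hz'0 (by omega) (Or.inl h2)
      have k' := key (z + Pi.single 1 1 + Pi.single 0 1) (by simp at hz'0 ⊢; omega)
        (by simp at hz'0' ⊢; omega) (Or.inl (by simpa using h2))
      refine (fun h => ?_ : ¬_) (hc.2 fun h => ?_)
      · have := k.1 h
        simp at this h2
        omega
      · have := k'.1 h
        simp at this h2
        omega
    · simp at h2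
      omega
  · obtain rfl : z = z' + Pi.single 1 1 := by simp [Site.eq_iff_two, h0, h1]
    rw [sepLo_comm, sepHi_comm, sepLo_add_e1, sepHi_add_e1] at hc
    rcases hz'1 with h2 | h2
    · simp at hz
      omega
    · have k := key (z' + Pi.single 1 1) (by simp; omega) (by simp; omega)
        (Or.inr (by simp; omega))
      have k' := key (z' + Pi.single 1 1 + Pi.single 0 1) (by simp; omega) (by simp; omega)
        (Or.inr (by simp; omega))
      exact hc.1 (k.2 (by simp; omega)) (k'.2 (by simp; omega))

/-- **Not both.** An open walk of `R` between the targets and a dual-open walk of allowed faces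
from the left group to the right group cannot coexist.
[cite: KohlerSchindlerTassion2023, §1 Duality, footnote 3] -/
theorem armDuality_not_both {x₁ x₂ y₁ y₂ u₁ u₂ : ℤ} (hxu : x₁ < u₁) (hu : u₁ < u₂) (hux : u₂ < x₂)
    (hy : y₁ < y₂) {ω : BondConfig (Site 2)} (hω : ω ⊆ (zdGraph 2).edgeSet)
    (hA : ω ∈ openCrossing {x : Site 2 | x₁ ≤ x 0 ∧ x 0 ≤ x₂ ∧ y₁ ≤ x 1 ∧ x 1 ≤ y₂}
      {x : Site 2 | u₁ ≤ x 0 ∧ x 0 ≤ u₂ ∧ x 1 = y₂} {x : Site 2 | u₁ ≤ x 0 ∧ x 0 ≤ u₂ ∧ x 1 = y₁})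
    (hB : dualConfig (ω ∩ {e | ∀ z ∈ e, x₁ ≤ z 0 ∧ z 0 ≤ x₂ ∧ y₁ ≤ z 1 ∧ z 1 ≤ y₂}) ∈
      openCrossing
        ({f : Site 2 | x₁ ≤ f 0 ∧ f 0 ≤ x₂ - 1 ∧ y₁ ≤ f 1 ∧ f 1 ≤ y₂ - 1} ∪
          {f : Site 2 | (f 0 = x₁ - 1 ∧ y₁ - 1 ≤ f 1 ∧ f 1 ≤ y₂) ∨
            ((f 1 = y₂ ∨ f 1 = y₁ - 1) ∧ x₁ ≤ f 0 ∧ f 0 ≤ u₁ - 1)} ∪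
          {f : Site 2 | (f 0 = x₂ ∧ y₁ - 1 ≤ f 1 ∧ f 1 ≤ y₂) ∨
            ((f 1 = y₂ ∨ f 1 = y₁ - 1) ∧ u₂ ≤ f 0 ∧ f 0 ≤ x₂ - 1)})
        {f : Site 2 | (f 0 = x₁ - 1 ∧ y₁ - 1 ≤ f 1 ∧ f 1 ≤ y₂) ∨
          ((f 1 = y₂ ∨ f 1 = y₁ - 1) ∧ x₁ ≤ f 0 ∧ f 0 ≤ u₁ - 1)}
        {f : Site 2 | (f 0 = x₂ ∧ y₁ - 1 ≤ f 1 ∧ f 1 ≤ y₂) ∨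
          ((f 1 = y₂ ∨ f 1 = y₁ - 1) ∧ u₂ ≤ f 0 ∧ f 0 ≤ x₂ - 1)}) : False := by
  classical
  obtain ⟨xa, hxa, xb, hxb, hab⟩ := hA
  rw [openConnIn_comm] at hab
  obtain ⟨P, hPs, hPe⟩ := exists_walk_of_mem_openConnIn hω hab
  obtain ⟨f, hf, g, hg, hfg⟩ := hB
  rw [openConnIn_comm] at hfg
  obtain ⟨Q, hQs, hQe⟩ := exists_walk_of_mem_openConnIn
    (fun _ h => h.1 : dualConfig (ω ∩ {e | ∀ z ∈ e, x₁ ≤ z 0 ∧ z 0 ≤ x₂ ∧ y₁ ≤ z 1 ∧ z 1 ≤ y₂}) ⊆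
      (zdGraph 2).edgeSet) hfg
  simp only [Set.mem_setOf_eq] at hxa hxb hPs hf hg
  -- the open walk, extended by one vertical edge at each end
  have hadj₁ : (zdGraph 2).Adj (xb - Pi.single 1 1) xb := adj_of_stepKind (.up (by simp) (by simp))
  have hadj₂ : (zdGraph 2).Adj xa (xa + Pi.single 1 1) := adj_of_stepKind (.up (by simp) (by simp))
  set P' : (zdGraph 2).Walk (xb - Pi.single 1 1) (xa + Pi.single 1 1) :=
    Walk.cons hadj₁ (P.concat hadj₂) with hP'
  have hP's : ∀ z ∈ P'.support, x₁ ≤ z 0 ∧ z 0 ≤ x₂ ∧ y₁ - 1 ≤ z 1 ∧ z 1 ≤ y₂ + 1 := by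
    intro z hz
    simp only [hP', Walk.support_cons, Walk.support_concat, List.mem_cons, List.mem_append,
      List.not_mem_nil, or_false] at hz
    rcases hz with rfl | hz | rfl
    · simp only [Pi.sub_apply, single_one_apply_zero, single_one_apply_one, sub_zero]; omega
    · have := hPs z hz; omega
    · simp only [Pi.add_apply, single_one_apply_zero, single_one_apply_one, add_zero]; omega
  -- the face walk, extended by straight runs to the outer columns
  obtain ⟨wR, hwR⟩ := exists_walk_row (p := ![x₂, g 1]) (q := g) (by simp)
    (by simp only [Matrix.cons_val_zero]; omega)
  obtain ⟨wL, hwL⟩ := exists_walk_row (p := f) (q := ![x₁ - 1, f 1]) (by simp)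
    (by simp only [Matrix.cons_val_zero]; omega)
  set Q' := wR.append (Q.append wL) with hQ'
  have hQ's : ∀ z ∈ Q'.support,
      z ∈ {f : Site 2 | x₁ ≤ f 0 ∧ f 0 ≤ x₂ - 1 ∧ y₁ ≤ f 1 ∧ f 1 ≤ y₂ - 1} ∪
        {f : Site 2 | (f 0 = x₁ - 1 ∧ y₁ - 1 ≤ f 1 ∧ f 1 ≤ y₂) ∨
          ((f 1 = y₂ ∨ f 1 = y₁ - 1) ∧ x₁ ≤ f 0 ∧ f 0 ≤ u₁ - 1)} ∪
        {f : Site 2 | (f 0 = x₂ ∧ y₁ - 1 ≤ f 1 ∧ f 1 ≤ y₂) ∨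
          ((f 1 = y₂ ∨ f 1 = y₁ - 1) ∧ u₂ ≤ f 0 ∧ f 0 ≤ x₂ - 1)} := by
    intro z hz
    rw [hQ', Walk.mem_support_append_iff, Walk.mem_support_append_iff] at hz
    rcases hz with hz | hz | hz
    · have := hwR z hz
      simp only [Matrix.cons_val_zero] at this
      simp only [Set.mem_union, Set.mem_setOf_eq]
      omega
    · exact hQs z hz
    · have := hwL z hz
      simp only [Matrix.cons_val_zero, Matrix.cons_val_one] at this
      simp only [Set.mem_union, Set.mem_setOf_eq]
      omega
  obtain ⟨dq, hdq, hE⟩ := exists_dart_sepEdge_mem_edges_box (L := x₁) (R := x₂) (B := y₁ - 1)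
    (T := y₂ + 1) P' Q' hP's
    (fun z hz => by
      have := hQ's z hz
      simp only [Set.mem_union, Set.mem_setOf_eq] at this
      omega)
    (by simp [hxb.2.2]) (by simp [hxa.2.2]) (by simp) (by simp)
  have hfst := hQ's _ (Q'.dart_fst_mem_support_of_mem_darts hdq)
  have hsnd := hQ's _ (Q'.dart_snd_mem_support_of_mem_darts hdq)
  have hE' : sepEdge dq.fst dq.snd = s(xb - Pi.single 1 1, xb) ∨ sepEdge dq.fst dq.snd ∈ P.edges ∨
      sepEdge dq.fst dq.snd = s(xa, xa + Pi.single 1 1) := by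
    simpa only [hP', Walk.edges_cons, Walk.edges_concat, List.concat_eq_append, List.mem_cons,
      List.mem_append, List.not_mem_nil, or_false] using hE
  rcases hE' with h | h | h
  · exact armDuality_sepEdge_ne hxu hu hux dq.adj hfst hsnd (w := xb - Pi.single 1 1)
      (by simp; omega) (by simp; omega) (Or.inl (by simp; omega)) (by rw [h, sub_add_cancel])
  · have hPR : ∀ w ∈ sepEdge dq.fst dq.snd, x₁ ≤ w 0 ∧ w 0 ≤ x₂ ∧ y₁ ≤ w 1 ∧ w 1 ≤ y₂ :=
      fun w hw => hPs w (mem_support_of_mem_edges' h hw)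
    rw [hQ', Walk.darts_append, List.mem_append, Walk.darts_append, List.mem_append] at hdq
    rcases hdq with hdq | hdq | hdq
    · have h1 := hwR _ (wR.dart_fst_mem_support_of_mem_darts hdq)
      have h2 := hwR _ (wR.dart_snd_mem_support_of_mem_darts hdq)
      simp only [Matrix.cons_val_zero] at h1 h2
      obtain ⟨v, hv, hv1, hv0⟩ := sepEdge_eq_of_row dq.adj (by omega)
      have hv2 := hPR v (by rw [hv]; exact Sym2.mem_mk_left _ _)
      have hv3 := hPR (v + Pi.single 1 1) (by rw [hv]; exact Sym2.mem_mk_right _ _)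
      simp only [Pi.add_apply, single_one_apply_zero, single_one_apply_one, add_zero] at hv3
      omega
    · exact sepEdge_notMem_of_dart hQe hdq ⟨hPe _ h, hPR⟩
    · have h1 := hwL _ (wL.dart_fst_mem_support_of_mem_darts hdq)
      have h2 := hwL _ (wL.dart_snd_mem_support_of_mem_darts hdq)
      simp only [Matrix.cons_val_zero, Matrix.cons_val_one] at h1 h2
      obtain ⟨v, hv, hv1, hv0⟩ := sepEdge_eq_of_row dq.adj (by omega)
      have hv2 := hPR v (by rw [hv]; exact Sym2.mem_mk_left _ _)
      have hv3 := hPR (v + Pi.single 1 1) (by rw [hv]; exact Sym2.mem_mk_right _ _)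
      simp only [Pi.add_apply, single_one_apply_zero, single_one_apply_one, add_zero] at hv3
      omega
  · exact armDuality_sepEdge_ne hxu hu hux dq.adj hfst hsnd (w := xa) (by omega) (by omega)
      (Or.inr hxa.2.2) h

/-- **At least one.** If the targets are not joined by an open walk of `R`, the dual configuration
of `ω ∩ E(R)` joins the left group of faces to the right group through allowed faces.
[cite: KohlerSchindlerTassion2023, §1 Duality, footnote 3] -/
theorem armDuality_dual_of_not_primal {x₁ x₂ y₁ y₂ u₁ u₂ : ℤ} (hxu : x₁ < u₁) (hu : u₁ < u₂)
    (hux : u₂ < x₂) (hy : y₁ < y₂) {ω : BondConfig (Site 2)}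
    (hA : ω ∉ openCrossing {x : Site 2 | x₁ ≤ x 0 ∧ x 0 ≤ x₂ ∧ y₁ ≤ x 1 ∧ x 1 ≤ y₂}
      {x : Site 2 | u₁ ≤ x 0 ∧ x 0 ≤ u₂ ∧ x 1 = y₂} {x : Site 2 | u₁ ≤ x 0 ∧ x 0 ≤ u₂ ∧ x 1 = y₁}) :
    dualConfig (ω ∩ {e | ∀ z ∈ e, x₁ ≤ z 0 ∧ z 0 ≤ x₂ ∧ y₁ ≤ z 1 ∧ z 1 ≤ y₂}) ∈
      openCrossing
        ({f : Site 2 | x₁ ≤ f 0 ∧ f 0 ≤ x₂ - 1 ∧ y₁ ≤ f 1 ∧ f 1 ≤ y₂ - 1} ∪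
          {f : Site 2 | (f 0 = x₁ - 1 ∧ y₁ - 1 ≤ f 1 ∧ f 1 ≤ y₂) ∨
            ((f 1 = y₂ ∨ f 1 = y₁ - 1) ∧ x₁ ≤ f 0 ∧ f 0 ≤ u₁ - 1)} ∪
          {f : Site 2 | (f 0 = x₂ ∧ y₁ - 1 ≤ f 1 ∧ f 1 ≤ y₂) ∨
            ((f 1 = y₂ ∨ f 1 = y₁ - 1) ∧ u₂ ≤ f 0 ∧ f 0 ≤ x₂ - 1)})
        {f : Site 2 | (f 0 = x₁ - 1 ∧ y₁ - 1 ≤ f 1 ∧ f 1 ≤ y₂) ∨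
          ((f 1 = y₂ ∨ f 1 = y₁ - 1) ∧ x₁ ≤ f 0 ∧ f 0 ≤ u₁ - 1)}
        {f : Site 2 | (f 0 = x₂ ∧ y₁ - 1 ≤ f 1 ∧ f 1 ≤ y₂) ∨
          ((f 1 = y₂ ∨ f 1 = y₁ - 1) ∧ u₂ ≤ f 0 ∧ f 0 ≤ x₂ - 1)} := by
  classical
  set ωR : BondConfig (Site 2) := ω ∩ {e | ∀ z ∈ e, x₁ ≤ z 0 ∧ z 0 ≤ x₂ ∧ y₁ ≤ z 1 ∧ z 1 ≤ y₂}
    with hωR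
  have hA' : ωR ∉ openCrossing {x : Site 2 | x₁ ≤ x 0 ∧ x 0 ≤ x₂ ∧ y₁ ≤ x 1 ∧ x 1 ≤ y₂}
      {x : Site 2 | u₁ ≤ x 0 ∧ x 0 ≤ u₂ ∧ x 1 = y₂} {x : Site 2 | u₁ ≤ x 0 ∧ x 0 ≤ u₂ ∧ x 1 = y₁} :=
    fun h => hA (isUpperSet_openCrossing _ _ _ Set.inter_subset_left h)
  obtain ⟨u, w, q, hu0, hw0, hqs, hqd⟩ := exists_faceWalk_box
    (fun x : Site 2 => x 1 = y₁ - 1 ∨ ∃ t ∈ {x : Site 2 | u₁ ≤ x 0 ∧ x 0 ≤ u₂ ∧ x 1 = y₁},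
      ωR ∈ openConnIn {x : Site 2 | x₁ ≤ x 0 ∧ x 0 ≤ x₂ ∧ y₁ ≤ x 1 ∧ x 1 ≤ y₂} x t)
    (L := x₁) (R := x₂) (B := y₁ - 1) (T := y₂ + 1) (by omega) (by omega)
    (fun x _ _ h => Or.inl h)
    (fun x _ _ h => by
      rintro (h' | ⟨t, -, ht⟩)
      · omega
      · have := ht.1
        simp only [Set.mem_setOf_eq] at this
        omega)
  -- no face above or below a target edge is visited
  have hmid : ∀ z ∈ q.support, ¬((z 1 = y₂ ∨ z 1 = y₁ - 1) ∧ u₁ ≤ z 0 ∧ z 0 ≤ u₂ - 1) := by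
    intro z hz hzm
    have hne : z ≠ u := by rintro rfl; omega
    have hz' : z ∈ q.darts.map (·.snd) := by
      rw [← Walk.cons_map_snd_darts, List.mem_cons] at hz
      exact hz.resolve_left hne
    obtain ⟨d, hd, rfl⟩ := List.mem_map.1 hz'
    have hfst := hqs _ (q.dart_fst_mem_support_of_mem_darts hd)
    exact armDuality_no_step_into_middle hxu hux hy hA' d.adj ⟨hfst.2.2.1, by omega⟩ hzm.1
      hzm.2.1 hzm.2.2 (hqd d hd).2
  have hS : ∀ z ∈ q.support,
      z ∈ {f : Site 2 | x₁ ≤ f 0 ∧ f 0 ≤ x₂ - 1 ∧ y₁ ≤ f 1 ∧ f 1 ≤ y₂ - 1} ∪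
        {f : Site 2 | (f 0 = x₁ - 1 ∧ y₁ - 1 ≤ f 1 ∧ f 1 ≤ y₂) ∨
          ((f 1 = y₂ ∨ f 1 = y₁ - 1) ∧ x₁ ≤ f 0 ∧ f 0 ≤ u₁ - 1)} ∪
        {f : Site 2 | (f 0 = x₂ ∧ y₁ - 1 ≤ f 1 ∧ f 1 ≤ y₂) ∨
          ((f 1 = y₂ ∨ f 1 = y₁ - 1) ∧ u₂ ≤ f 0 ∧ f 0 ≤ x₂ - 1)} := by
    intro z hz
    have h1 := hqs z hz
    have h2 := hmid z hz
    simp only [Set.mem_union, Set.mem_setOf_eq]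
    omega
  -- every step crosses a closed or outside edge
  have hE : ∀ e ∈ q.edges, e ∈ dualConfig ωR := by
    refine edges_mem_dualConfig_of_forall_sepEdge fun d hd hmem => ?_
    have hc := (hqd d hd).2
    have hlo : sepLo d.fst d.snd ∈ {x : Site 2 | x₁ ≤ x 0 ∧ x 0 ≤ x₂ ∧ y₁ ≤ x 1 ∧ x 1 ≤ y₂} :=
      hmem.2 _ (sepLo_mem_sepEdge _ _)
    have hhi : sepHi d.fst d.snd ∈ {x : Site 2 | x₁ ≤ x 0 ∧ x 0 ≤ x₂ ∧ y₁ ≤ x 1 ∧ x 1 ≤ y₂} :=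
      hmem.2 _ (by rw [sepEdge]; exact Sym2.mem_mk_right _ _)
    have hne : sepLo d.fst d.snd ≠ sepHi d.fst d.snd :=
      ((zdGraph 2).mem_edgeSet.1 (sepEdge_mem_edgeSet d.adj)).ne
    have h1 := openConnIn_of_adj (ω := ωR) hlo hhi hmem hne
    have h2 : ωR ∈ openConnIn {x : Site 2 | x₁ ≤ x 0 ∧ x 0 ≤ x₂ ∧ y₁ ≤ x 1 ∧ x 1 ≤ y₂}
        (sepHi d.fst d.snd) (sepLo d.fst d.snd) := by
      rw [openConnIn_comm]; exact h1
    have hlo1 : (sepLo d.fst d.snd) 1 ≠ y₁ - 1 := by have := hlo.2.2.1; omega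
    have hhi1 : (sepHi d.fst d.snd) 1 ≠ y₁ - 1 := by have := hhi.2.2.1; omega
    have hiff : (∃ t ∈ {x : Site 2 | u₁ ≤ x 0 ∧ x 0 ≤ u₂ ∧ x 1 = y₁},
        ωR ∈ openConnIn {x : Site 2 | x₁ ≤ x 0 ∧ x 0 ≤ x₂ ∧ y₁ ≤ x 1 ∧ x 1 ≤ y₂}
          (sepLo d.fst d.snd) t) ↔
        (∃ t ∈ {x : Site 2 | u₁ ≤ x 0 ∧ x 0 ≤ u₂ ∧ x 1 = y₁},
          ωR ∈ openConnIn {x : Site 2 | x₁ ≤ x 0 ∧ x 0 ≤ x₂ ∧ y₁ ≤ x 1 ∧ x 1 ≤ y₂}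
            (sepHi d.fst d.snd) t) :=
      ⟨fun ⟨t, ht, h⟩ => ⟨t, ht, PlanarDuality.openConnIn_trans h2 h⟩,
        fun ⟨t, ht, h⟩ => ⟨t, ht, PlanarDuality.openConnIn_trans h1 h⟩⟩
    by_cases he : ∃ t ∈ {x : Site 2 | u₁ ≤ x 0 ∧ x 0 ≤ u₂ ∧ x 1 = y₁},
        ωR ∈ openConnIn {x : Site 2 | x₁ ≤ x 0 ∧ x 0 ≤ x₂ ∧ y₁ ≤ x 1 ∧ x 1 ≤ y₂}
          (sepLo d.fst d.snd) t
    · exact hc.1 (Or.inr he) (Or.inr (hiff.1 he))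
    · rcases hc.2 (by rintro (h | h); exacts [hhi1 h, he (hiff.2 h)]) with h | h
      exacts [hlo1 h, he h]
  refine ⟨w, ?_, u, ?_, ?_⟩
  · have := hqs w q.end_mem_support
    exact Or.inl ⟨hw0, by omega, by omega⟩
  · have := hqs u q.start_mem_support
    exact Or.inl ⟨hu0, by omega, by omega⟩
  · rw [openConnIn_comm]
    exact mem_openConnIn_of_walk q hS hE

/-- **Arm / dual-bridge duality** ([KohlerSchindlerTassion2023, §1 'Duality' and footnote 3]):
discharge of `KSTPeriodic.ArmDuality`. For a lattice configuration `ω`, the rectangle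
`R = [x₁, x₂] × [y₁, y₂]` and targets `[u₁, u₂] × {y₂}`, `[u₁, u₂] × {y₁}` (`x₁ < u₁ < u₂ < x₂`,
`y₁ < y₂`), exactly one of "an open path of `R` joins the targets" and "the dual configuration of
`ω ∩ E(R)` joins the left group of faces to the right group through allowed faces" holds.
[cite: KohlerSchindlerTassion2023, §1 Duality, footnote 3] -/
theorem armDuality : ArmDuality := by
  intro x₁ x₂ y₁ y₂ u₁ u₂ hxu hu hux hy ω hω
  by_cases hA : ω ∈ openCrossing {x : Site 2 | x₁ ≤ x 0 ∧ x 0 ≤ x₂ ∧ y₁ ≤ x 1 ∧ x 1 ≤ y₂}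
      {x : Site 2 | u₁ ≤ x 0 ∧ x 0 ≤ u₂ ∧ x 1 = y₂} {x : Site 2 | u₁ ≤ x 0 ∧ x 0 ≤ u₂ ∧ x 1 = y₁}
  · exact Or.inl ⟨hA, fun hB => armDuality_not_both hxu hu hux hy hω hA hB⟩
  · exact Or.inr ⟨armDuality_dual_of_not_primal hxu hu hux hy hA, hA⟩

end KSTPeriodic

end

end Literature.Probability.Percolation

namespace Literature.Probability.Percolation.KSTPeriodic

/-- **`ArmDuality` is a theorem of the tree (audit alias).** The named fact `ArmDuality`
(`KSTPeriodicStatements.lean`): Arm / dual-bridge duality ([KohlerSchindlerTassion2023, §1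
Duality and footnote 3]): … — is proved outright by `armDuality` (this file); this alias
records the discharge under the census/audit name `ArmDuality_holds` (librarian sweep g25,
pass 5c; no new mathematics).
[cite: KohlerSchindlerTassion2023, §1 Duality] -/
theorem ArmDuality_holds :
    ArmDuality :=
  armDuality

end Literature.Probability.Percolation.KSTPeriodic
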